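import Literature.AnabelianGeometry.EtaleTheta.DivisorMonoidsOfGaloisCoveringConnected
import Literature.AnabelianGeometry.EtaleTheta.Discharge.Sec3Prop34iiOfGaloisCovering
import Literature.AnabelianGeometry.EtaleTheta.Discharge.Sec3Prop34iPhiZero
import Literature.AnabelianGeometry.EtaleTheta.FrdIVocabulary

/-!
# [EtTh] Prop. 3.4 (i) at the constructed Def. 3.3 (iii) data: NON-DILATING endomorphisms and "divisorial monoid
# on `D₀`" over the connected coverings — and Prop. 3.4 AS A WHOLE at `DivisorMonoids.ofGaloisActionConnected`

S. Mochizuki, *The étale theta function …*, Publ. RIMS **45** (2009) [MochizukiEtTh2009], §3, Prop. 3.4 (i), PRIMS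
PDF p.74 (printed 300): "`Φ₀(Y^log)` … is perf-factorial.  Moreover, every endomorphism of `Φ₀(Y^log)` … induced by an
endomorphism of `Y^log` over `X^log` is non-dilating.  In particular, the functor `Φ₀` defines a divisorial monoid on
`D₀` which is, moreover, perf-factorial and non-dilating"; proof p.75 l.5–9: "let `α` be an endomorphism of `M` that is
induced by an endomorphism of `Y^log` over `X^log` such that `α` induces the identity endomorphism on the set of primes
of `M`.  Then by considering local functions on `Z_∞` that arise from local functions on `X` and vanish at various
primes of `M`, it follows that `α` is the identity"; Rmk. 3.3.1 p.73: "the set of primes of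
`Div⁺(Z^log_∞)^{Gal(Z^log_∞/Y^log)}` … is in natural bijective correspondence with the set of
`Gal(Z^log_∞/Y^log)`-orbits of prime log-divisors on `Z^log_∞`" [cite: MochizukiEtTh2009, Prop 3.4 p.74].

PROOF-ONLY companion (abc-iut cell, W6 seat d058, part (B) of the EtTh:Prop3.4 chain at constructed data; 0 defs).
At the Def. 3.3 (iii) data built from ONE universal combinatorial covering (`Z : LogDivisorModel`,
`A : Z.GaloisAction G`, abc-iut-w6-d058: `DivisorMonoids.ofGaloisAction`, `…Connected`) the Prop. 3.4 (i) clauses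
that abc-iut-w6-d057's `prop34_i_phiZero` (weak perf-factoriality of every `Φ₀(S) = Hom_G(S, Div⁺(Z^log_∞))`,
`Discharge/Sec3Prop34iPhiZero.lean`) leaves are PROVED:

* **non-dilating** — `isNonDilating_phiZeroPull`: for EVERY `G`-set `S` and EVERY endomorphism `f : S ⟶ S`, the
  pull-back `Φ₀(f) : Φ₀(S) → Φ₀(S)` is non-dilating ([FrdI] Def. 1.1 (i): if `Φ₀(f)(p) ≼ p` for every prime `p`
  then `Φ₀(f) = id`).  ROUTE (Rmk. 3.3.1 in place of print's "local functions"): an element of `Φ₀(S)` is a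
  `G`-invariant multiplicity function on `S × (cusps ⊔ components)` (`mult_phiZero_ρ`); the `n`-fold orbit
  indicators (`n` = the exponent of Prop. 3.2 (i), so that they are CARTIER) lie in `Φ₀(S)` and are PRIMARY
  (`exists_orbitIndicator`, `isPrimary_of_orbitIndicator`); `Φ₀(f)(p_O) ≼ p_O` for the orbit `O` of `(f s, x)`
  forces `(s, x) ∈ O` (`mem_orbit_of_precsim`), whence `Φ₀(f) φ = φ` for every invariant `φ`;
* **divisorial monoid on `D₀`** over the CONNECTED coverings (`isConnectedGSet`, w6-d058 file 5) in the tree's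
  category vocabulary `treeCatVocab`: `isMonoidOn_ofGaloisActionConnected` ([FrdI] Def. 1.1 (ii): pull-backs
  characteristically injective — covering maps of connected coverings are surjective and `Φ₀(S)` is sharp — and
  bijective along FSM-morphisms — monomorphisms of connected coverings are bijective) and
  `objectwise_isDivisorial_ofGaloisActionConnected` (from w6-d057's weak perf-factoriality);
* **capstone** — `prop34_ofGaloisActionConnected : (ofGaloisActionConnected A hZ).Prop34 treeMonoidVocabWeak
  (treeCatVocab _ R R')` OUTRIGHT (the [FrdI] Def. 4.5 rationality slots `R`, `R'` of `treeCatVocab` are not read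
  by `Prop34`): [EtTh] Prop. 3.4, (i) in the cell's weak reading of [FrdI] Def. 2.4 (d) (F-L2d2-1, F-L2d2-2) and (ii), is a
  THEOREM at the Def. 3.3 (iii) data of the connected coverings dominated by one universal combinatorial covering;
  over ALL `G`-sets, `prop34_ofGaloisAction_weak_iff_isDivisorialOn` isolates the only remaining slot (the category
  vocabulary; `treeCatVocab`'s injectivity of pull-backs fails along non-surjective maps of disconnected `G`-sets).
HONEST FRAMING: theorems about a construction over typed interfaces (one term of the inductive limit of Def. 3.3
(iii); the tacit cusp laws enter as the binder `hZ`, GAP G-w6d058-1); nothing here bears on [IUTchIII] Cor. 3.12;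
no side taken; typed ≠ proved for anything not stated here.
-/

namespace Literature.AnabelianGeometry.EtaleTheta

open CategoryTheory Opposite Literature.AlgebraicGeometry.Frobenioids

universe u

namespace LogDivisorModel

variable (Z : LogDivisorModel.{u})

/-- A log-divisor with non-negative `ℤ`-coordinates is effective. [cite: MochizukiEtTh2009, Def 3.1 p.70] -/
theorem mem_DIVplus_of_coord_nonneg {d : Z.DIV} (h : ∀ x, 0 ≤ Z.coord d x) : d ∈ Z.DIVplus := by
  have hneg : Z.negPart d = 1 := Z.eq_of_mult_eq fun x => by
    rw [negPart, mult_ofMult, mult_one, Int.toNat_eq_zero]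
    linarith [h x]
  have hd : d = Z.posPart d := by rw [← mul_negPart_eq_posPart, hneg, OneMemClass.coe_one, mul_one]
  rw [hd]
  exact (Z.posPart d).2

end LogDivisorModel

namespace LogDivisorModel.GaloisAction

variable {Z : LogDivisorModel.{u}} {G : Type u} [Group G] (A : Z.GaloisAction G) (S : Action (Type u) G)

/-! ## Elements of `Φ₀(S)` as invariant multiplicity functions on `S × (cusps ⊔ components)` -/

/-- The multiplicity function of `φ ∈ Φ₀(S)` is invariant under the diagonal action: `m_φ(g·s, g·x) = m_φ(s, x)`.
[cite: MochizukiEtTh2009, Rmk 3.3.1 p.73] -/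
theorem mult_phiZero_ρ (φ : A.phiZero S) (g : G) (s : S.V) (x : Z.Idx) :
    Z.mult ⟨φ.1 (S.ρ g s), (φ.2.1 _).2⟩ (A.permIdx g x) = Z.mult ⟨φ.1 s, (φ.2.1 s).2⟩ x := by
  have e : (⟨φ.1 (S.ρ g s), (φ.2.1 _).2⟩ : Z.DIVplus) = A.actDIVplus g ⟨φ.1 s, (φ.2.1 s).2⟩ :=
    Subtype.ext (φ.2.2 g s)
  rw [e, mult_actDIVplus]

/-- Two elements of `Φ₀(S)` with the same multiplicity function are equal. [cite: MochizukiEtTh2009, Def 3.3 p.73] -/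
theorem phiZero_ext {φ ψ : A.phiZero S}
    (h : ∀ s x, Z.mult ⟨φ.1 s, (φ.2.1 s).2⟩ x = Z.mult ⟨ψ.1 s, (ψ.2.1 s).2⟩ x) : φ = ψ :=
  Subtype.ext (funext fun s => congrArg Subtype.val (Z.eq_of_mult_eq (h s)))

/-- Multiplicities of a product. [cite: MochizukiEtTh2009, Def 3.3 p.73] -/
theorem mult_phiZero_mul (φ ψ : A.phiZero S) (s : S.V) (x : Z.Idx) :
    Z.mult ⟨(φ * ψ).1 s, ((φ * ψ).2.1 s).2⟩ x = Z.mult ⟨φ.1 s, (φ.2.1 s).2⟩ x + Z.mult ⟨ψ.1 s, (ψ.2.1 s).2⟩ x := by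
  rw [← Z.mult_mul]
  rfl

/-- Multiplicities of a power. [cite: MochizukiEtTh2009, Def 3.3 p.73] -/
theorem mult_phiZero_pow (φ : A.phiZero S) (n : ℕ) (s : S.V) (x : Z.Idx) :
    Z.mult ⟨(φ ^ n).1 s, ((φ ^ n).2.1 s).2⟩ x = n * Z.mult ⟨φ.1 s, (φ.2.1 s).2⟩ x := by
  induction n with
  | zero => rw [pow_zero, Nat.zero_mul]; exact Z.mult_one x
  | succ n ih => rw [pow_succ, mult_phiZero_mul, ih, Nat.succ_mul]

/-- Divisibility in `Φ₀(S)` is pointwise `≤` of multiplicities. [cite: MochizukiEtTh2009, Def 3.3 p.73] -/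
theorem mult_le_of_dvd {φ ψ : A.phiZero S} (h : φ ∣ ψ) (s : S.V) (x : Z.Idx) :
    Z.mult ⟨φ.1 s, (φ.2.1 s).2⟩ x ≤ Z.mult ⟨ψ.1 s, (ψ.2.1 s).2⟩ x := by
  obtain ⟨c, rfl⟩ := h
  rw [mult_phiZero_mul]
  exact Nat.le_add_right _ _

/-- Conversely pointwise `≤` of multiplicities gives divisibility in `Φ₀(S)` (the quotient is effective by the
coordinates, Cartier as a quotient of Cartier log-divisors, and equivariant). [cite: MochizukiEtTh2009, Def 3.3 p.73] -/
theorem dvd_of_mult_le {φ ψ : A.phiZero S}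
    (h : ∀ s x, Z.mult ⟨φ.1 s, (φ.2.1 s).2⟩ x ≤ Z.mult ⟨ψ.1 s, (ψ.2.1 s).2⟩ x) : φ ∣ ψ := by
  have hq : (fun s => ψ.1 s / φ.1 s) ∈ A.phiZero S := by
    refine ⟨fun s => ⟨Z.Div.div_mem (ψ.2.1 s).1 (φ.2.1 s).1, Z.mem_DIVplus_of_coord_nonneg fun x => ?_⟩,
      fun g s => ?_⟩
    · show 0 ≤ Z.coord (ψ.1 s / φ.1 s) x
      rw [div_eq_mul_inv, Z.coord_mul, Z.coord_inv, Z.coord_of_mem (ψ.2.1 s).2, Z.coord_of_mem (φ.2.1 s).2]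
      have := h s x
      omega
    · show ψ.1 (S.ρ g s) / φ.1 (S.ρ g s) = _
      rw [ψ.2.2, φ.2.2, map_div]
  refine ⟨⟨_, hq⟩, Subtype.ext (funext fun s => ?_)⟩
  show ψ.1 s = φ.1 s * (ψ.1 s / φ.1 s)
  rw [mul_div_cancel]

/-! ## Orbit indicators: the primes of `Φ₀(S)` (Rmk. 3.3.1) -/

/-- **The `n`-fold indicator of the orbit of `(s₀, x₀)` lies in `Φ₀(S)`** (`n` = the exponent of Prop. 3.2 (i), so
that the values are Cartier): there is `p ∈ Φ₀(S)` with multiplicity `n` on the diagonal `G`-orbit of `(s₀, x₀)`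
and `0` off it. [cite: MochizukiEtTh2009, Rmk 3.3.1 p.73] -/
theorem exists_orbitIndicator (s₀ : S.V) (x₀ : Z.Idx) : ∃ p : A.phiZero S, ∀ s x,
    ((∃ g : G, S.ρ g s₀ = s ∧ A.permIdx g x₀ = x) → Z.mult ⟨p.1 s, (p.2.1 s).2⟩ x = (Z.cartierExp : ℕ)) ∧
    ((¬ ∃ g : G, S.ρ g s₀ = s ∧ A.permIdx g x₀ = x) → Z.mult ⟨p.1 s, (p.2.1 s).2⟩ x = 0) := by
  classical
  -- the indicator `1_O` as a family of effective log-divisors, and its `n`-th power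
  let ind : S.V → Z.DIVplus := fun s =>
    Z.ofMult fun x => if ∃ g : G, S.ρ g s₀ = s ∧ A.permIdx g x₀ = x then 1 else 0
  have hind_ρ : ∀ (g : G) (s : S.V), ind (S.ρ g s) = A.actDIVplus g (ind s) := by
    intro g s
    refine Z.eq_of_mult_eq fun y => ?_
    obtain ⟨x, rfl⟩ := A.permIdx_surjective g y
    rw [mult_actDIVplus]
    simp only [ind, mult_ofMult]
    have hiff : (∃ g' : G, S.ρ g' s₀ = S.ρ g s ∧ A.permIdx g' x₀ = A.permIdx g x) ↔
        ∃ g' : G, S.ρ g' s₀ = s ∧ A.permIdx g' x₀ = x := by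
      constructor
      · rintro ⟨g', h1, h2⟩
        refine ⟨g⁻¹ * g', ?_, ?_⟩
        · rw [map_mul]
          change S.ρ g⁻¹ (S.ρ g' s₀) = s
          rw [h1, ← types_comp_apply (S.ρ g) (S.ρ g⁻¹), ← End.mul_def, ← map_mul, inv_mul_cancel, map_one]
          rfl
        · rw [map_mul, Equiv.Perm.mul_apply, h2, ← Equiv.Perm.mul_apply, ← map_mul, inv_mul_cancel, map_one,
            Equiv.Perm.one_apply]
      · rintro ⟨g', h1, h2⟩
        refine ⟨g * g', ?_, ?_⟩
        · rw [map_mul]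
          change S.ρ g (S.ρ g' s₀) = S.ρ g s
          rw [h1]
        · rw [map_mul, Equiv.Perm.mul_apply, h2]
    simp only [hiff]
  refine ⟨⟨fun s => (ind s : Z.DIV) ^ (Z.cartierExp : ℕ),
    fun s => ⟨Z.pow_cartierExp_mem_Div _, Z.DIVplus.pow_mem (ind s).2 _⟩,
    fun g s => by
      show (ind (S.ρ g s) : Z.DIV) ^ (Z.cartierExp : ℕ) = _
      rw [hind_ρ, coe_actDIVplus, map_pow]⟩, fun s x => ?_⟩
  have hm : Z.mult ⟨(ind s : Z.DIV) ^ (Z.cartierExp : ℕ), Z.DIVplus.pow_mem (ind s).2 _⟩ x =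
      (Z.cartierExp : ℕ) * Z.mult (ind s) x := by
    have e : (⟨(ind s : Z.DIV) ^ (Z.cartierExp : ℕ), Z.DIVplus.pow_mem (ind s).2 _⟩ : Z.DIVplus) =
        ind s ^ (Z.cartierExp : ℕ) := rfl
    rw [e]
    induction (Z.cartierExp : ℕ) with
    | zero => rw [pow_zero, mult_one, Nat.zero_mul]
    | succ n ih => rw [pow_succ, mult_mul, ih, Nat.succ_mul]
  refine ⟨fun h => ?_, fun h => ?_⟩
  · rw [hm]; simp only [ind, mult_ofMult, if_pos h, mul_one]
  · rw [hm]; simp only [ind, mult_ofMult, if_neg h, mul_zero]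

/-- An element of `Φ₀(S)` DIVIDING a power of an orbit indicator is a multiple of the indicator: its multiplicity
function is a constant `k` on the orbit and `0` off it. [cite: MochizukiEtTh2009, Rmk 3.3.1 p.73] -/
theorem mult_of_precsim_orbitIndicator {s₀ : S.V} {x₀ : Z.Idx} {p : A.phiZero S}
    (hp : ∀ s x, ((∃ g : G, S.ρ g s₀ = s ∧ A.permIdx g x₀ = x) → Z.mult ⟨p.1 s, (p.2.1 s).2⟩ x = (Z.cartierExp : ℕ)) ∧
      ((¬ ∃ g : G, S.ρ g s₀ = s ∧ A.permIdx g x₀ = x) → Z.mult ⟨p.1 s, (p.2.1 s).2⟩ x = 0))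
    {ψ : A.phiZero S} (hψ : Precsim ψ p) (s : S.V) (x : Z.Idx) :
    ((∃ g : G, S.ρ g s₀ = s ∧ A.permIdx g x₀ = x) →
        Z.mult ⟨ψ.1 s, (ψ.2.1 s).2⟩ x = Z.mult ⟨ψ.1 s₀, (ψ.2.1 s₀).2⟩ x₀) ∧
      ((¬ ∃ g : G, S.ρ g s₀ = s ∧ A.permIdx g x₀ = x) → Z.mult ⟨ψ.1 s, (ψ.2.1 s).2⟩ x = 0) := by
  obtain ⟨n, _, hdvd⟩ := hψ
  refine ⟨?_, fun h => ?_⟩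
  · rintro ⟨g, rfl, rfl⟩
    exact A.mult_phiZero_ρ S ψ g s₀ x₀
  · have hle := A.mult_le_of_dvd S hdvd s x
    rw [mult_phiZero_pow, (hp s x).2 h, mul_zero] at hle
    exact Nat.le_zero.mp hle

/-- **Orbit indicators are PRIMARY elements of `Φ₀(S)`** ("the primes of `Div⁺(Z^log_∞)^{Gal}` are the Galois orbits
of prime log-divisors", Rmk. 3.3.1). [cite: MochizukiEtTh2009, Rmk 3.3.1 p.73] -/
theorem isPrimary_of_orbitIndicator {s₀ : S.V} {x₀ : Z.Idx} {p : A.phiZero S}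
    (hp : ∀ s x, ((∃ g : G, S.ρ g s₀ = s ∧ A.permIdx g x₀ = x) → Z.mult ⟨p.1 s, (p.2.1 s).2⟩ x = (Z.cartierExp : ℕ)) ∧
      ((¬ ∃ g : G, S.ρ g s₀ = s ∧ A.permIdx g x₀ = x) → Z.mult ⟨p.1 s, (p.2.1 s).2⟩ x = 0)) :
    IsPrimary p := by
  have hN : 0 < (Z.cartierExp : ℕ) := Z.cartierExp.pos
  have hrefl : ∃ g : G, S.ρ g s₀ = s₀ ∧ A.permIdx g x₀ = x₀ :=
    ⟨1, by rw [map_one]; rfl, by rw [map_one, Equiv.Perm.one_apply]⟩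
  refine ⟨fun h1 => ?_, fun ψ hψ1 hψp => ?_⟩
  · -- `p ≠ 1`: multiplicity `n ≥ 1` at `(s₀, x₀)`
    have h0 := (hp s₀ x₀).1 hrefl
    rw [h1] at h0
    have : Z.mult ⟨(1 : A.phiZero S).1 s₀, ((1 : A.phiZero S).2.1 s₀).2⟩ x₀ = 0 := Z.mult_one x₀
    omega
  · -- `ψ ≼ p`, `ψ ≠ 1`: `ψ = k · 1_O` with `k ≥ 1`, so `p ∣ ψ ^ n`
    have hψ := A.mult_of_precsim_orbitIndicator S hp hψp
    have hk : 0 < Z.mult ⟨ψ.1 s₀, (ψ.2.1 s₀).2⟩ x₀ := by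
      rcases Nat.eq_zero_or_pos (Z.mult ⟨ψ.1 s₀, (ψ.2.1 s₀).2⟩ x₀) with hk0 | hk
      · refine absurd (A.phiZero_ext S fun s x => ?_) hψ1
        rw [show Z.mult ⟨(1 : A.phiZero S).1 s, ((1 : A.phiZero S).2.1 s).2⟩ x = 0 from Z.mult_one x]
        by_cases h : ∃ g : G, S.ρ g s₀ = s ∧ A.permIdx g x₀ = x
        · rw [(hψ s x).1 h, hk0]
        · exact (hψ s x).2 h
      · exact hk
    refine ⟨(Z.cartierExp : ℕ), hN, A.dvd_of_mult_le S fun s x => ?_⟩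
    rw [mult_phiZero_pow]
    by_cases h : ∃ g : G, S.ρ g s₀ = s ∧ A.permIdx g x₀ = x
    · rw [(hp s x).1 h, (hψ s x).1 h]
      exact Nat.le_mul_of_pos_right _ hk
    · rw [(hp s x).2 h]
      exact Nat.zero_le _

/-! ## Non-dilating pull-backs -/

/-- **The key step**: if the pull-back `Φ₀(f)` along an endomorphism `f : S ⟶ S` satisfies `Φ₀(f)(p) ≼ p` for the
indicator `p` of the orbit of `(f s, x)`, then `(s, x)` lies in that orbit. [cite: MochizukiEtTh2009, Prop 3.4 p.74] -/
theorem mem_orbit_of_precsim (f : S ⟶ S) (s : S.V) (x : Z.Idx) {p : A.phiZero S}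
    (hp : ∀ s' x', ((∃ g : G, S.ρ g (f.hom s) = s' ∧ A.permIdx g x = x') →
        Z.mult ⟨p.1 s', (p.2.1 s').2⟩ x' = (Z.cartierExp : ℕ)) ∧
      ((¬ ∃ g : G, S.ρ g (f.hom s) = s' ∧ A.permIdx g x = x') → Z.mult ⟨p.1 s', (p.2.1 s').2⟩ x' = 0))
    (h : Precsim (A.phiZeroPull f p) p) : ∃ g : G, S.ρ g (f.hom s) = s ∧ A.permIdx g x = x := by
  by_contra hnot
  have hzero := (A.mult_of_precsim_orbitIndicator S hp h s x).2 hnot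
  -- but the multiplicity of `Φ₀(f)(p)` at `(s, x)` is that of `p` at `(f s, x)`, namely `n ≠ 0`
  have hrefl : ∃ g : G, S.ρ g (f.hom s) = f.hom s ∧ A.permIdx g x = x :=
    ⟨1, by rw [map_one]; rfl, by rw [map_one, Equiv.Perm.one_apply]⟩
  have hn := (hp (f.hom s) x).1 hrefl
  have e : Z.mult ⟨(A.phiZeroPull f p).1 s, ((A.phiZeroPull f p).2.1 s).2⟩ x = Z.mult ⟨p.1 (f.hom s), (p.2.1 _).2⟩ x := rfl
  rw [e, hn] at hzero
  exact absurd hzero (ne_of_gt Z.cartierExp.pos)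

/-- **[EtTh] Prop. 3.4 (i), non-dilating clause, at the constructed data**: for every `G`-set `S` and every
endomorphism `f : S ⟶ S` (an endomorphism of the covering over `X^log`), the induced endomorphism `Φ₀(f)` of
`Φ₀(S) = Hom_G(S, Div⁺(Z^log_∞))` is NON-DILATING ([FrdI] Def. 1.1 (i)).  Route: Rmk. 3.3.1's orbits instead of
print's local functions. [cite: MochizukiEtTh2009, Prop 3.4 p.74] -/
theorem isNonDilating_phiZeroPull (f : S ⟶ S) : IsNonDilating (A.phiZeroPull f) := by
  intro hprim
  -- every `(s, x)` lies in the orbit of `(f s, x)`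
  have horb : ∀ (s : S.V) (x : Z.Idx), ∃ g : G, S.ρ g (f.hom s) = s ∧ A.permIdx g x = x := by
    intro s x
    obtain ⟨p, hp⟩ := A.exists_orbitIndicator S (f.hom s) x
    refine A.mem_orbit_of_precsim S f s x hp ?_
    have h := hprim (Associates.mk p) ?_
    · rw [associatesMap_mk] at h
      obtain ⟨n, hn, hdvd⟩ := h
      exact ⟨n, hn, by rwa [← Associates.mk_pow, Associates.mk_dvd_mk] at hdvd⟩
    · -- primality transfers to `Associates` (a sharp monoid would do; we check the two clauses directly)
      have hP := A.isPrimary_of_orbitIndicator S hp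
      refine ⟨fun h1 => hP.1 ?_, fun b hb hbp => ?_⟩
      · rw [Associates.mk_eq_one] at h1
        obtain ⟨u, hu⟩ := h1
        have hu1 : (u : A.phiZero S) = 1 := by
          refine A.phiZero_ext S fun s x => ?_
          have hle := A.mult_le_of_dvd S (u.isUnit.dvd : (u : A.phiZero S) ∣ 1) s x
          have h1 : Z.mult ⟨(1 : A.phiZero S).1 s, ((1 : A.phiZero S).2.1 s).2⟩ x = 0 := Z.mult_one x
          rw [h1] at hle ⊢
          exact Nat.le_zero.mp hle
        rw [← hu, hu1]
      · obtain ⟨b, rfl⟩ := Associates.mk_surjective b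
        have hb' : b ≠ 1 := fun hb1 => hb (by rw [hb1, Associates.mk_one])
        obtain ⟨n, hn, hdvd⟩ := hbp
        rw [← Associates.mk_pow, Associates.mk_dvd_mk] at hdvd
        obtain ⟨m, hm, hdvd'⟩ := hP.2 b hb' ⟨n, hn, hdvd⟩
        exact ⟨m, hm, by rw [← Associates.mk_pow, Associates.mk_dvd_mk]; exact hdvd'⟩
  -- hence `Φ₀(f) φ = φ` for every `φ`
  have hid : ∀ φ : A.phiZero S, A.phiZeroPull f φ = φ := fun φ => A.phiZero_ext S fun s x => by
    obtain ⟨g, hs, hx⟩ := horb s x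
    have e : Z.mult ⟨(A.phiZeroPull f φ).1 s, ((A.phiZeroPull f φ).2.1 s).2⟩ x = Z.mult ⟨φ.1 (f.hom s), (φ.2.1 _).2⟩ x := rfl
    rw [e]
    have h := A.mult_phiZero_ρ S φ g (f.hom s) x
    rw [hx] at h
    rw [← h]
    congr 1
    exact Subtype.ext (congrArg φ.1 hs)
  refine MonoidHom.ext fun a => ?_
  obtain ⟨φ, rfl⟩ := Associates.mk_surjective a
  rw [associatesMap_mk, hid, MonoidHom.id_apply]

end LogDivisorModel.GaloisAction

/-! ## Prop. 3.4 at `ofGaloisAction` / `ofGaloisActionConnected` -/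

namespace DivisorMonoids

open LogDivisorModel.GaloisAction

variable {Z : LogDivisorModel.{u}} {G : Type u} [Group G] (A : Z.GaloisAction G) (hZ : Z.CuspLaws)

/-- Injective homomorphisms into SHARP monoids are characteristically injective ([FrdI] §0; universe-polymorphic
form of `isCharInjective_of_injective`). [cite: MochizukiFrdI2008, §0 p.11] -/
private theorem isCharInjective_of_injective_sharp {M N : Type u} [CommMonoid M] [CommMonoid N] (φ : M →* N)
    (hφ : Function.Injective φ) (hN : IsSharp N) : IsCharInjective φ := by
  refine ⟨hφ, fun x y hxy => ?_⟩
  obtain ⟨a, rfl⟩ := Associates.mk_surjective x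
  obtain ⟨b, rfl⟩ := Associates.mk_surjective y
  rw [associatesMap_mk, associatesMap_mk, Associates.mk_eq_mk_iff_associated] at hxy
  obtain ⟨u, hu⟩ := hxy
  have hu1 : (u : N) = 1 := hN.1 _ u.isUnit
  rw [hu1, mul_one] at hu
  rw [hφ hu]

/-- **Over ALL `G`-sets** the typed Prop. 3.4 at the weak monoid vocabulary REDUCES to its category-vocabulary slot:
perf-factorial (abc-iut-w6-d057), non-dilating and (ii) are theorems. [cite: MochizukiEtTh2009, Prop 3.4 p.74] -/
theorem prop34_ofGaloisAction_weak_iff_isDivisorialOn (V₀ : FrdICatStub.{u + 1, u, u} (Action (Type u) G)) :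
    (ofGaloisAction A hZ).Prop34 treeMonoidVocabWeak V₀ ↔ V₀.IsDivisorialOn (ofGaloisAction A hZ).Φ₀ := by
  rw [prop34_ofGaloisAction_iff]
  exact ⟨fun h => h.2.2, fun h => ⟨fun Y => prop34_i_phiZero A Y.unop,
    fun Y f => isNonDilating_phiZeroPull A Y.unop f.unop, h⟩⟩

/-- `Φ₀(S)` is divisorial for every `G`-set `S` (from abc-iut-w6-d057's weak perf-factoriality).
[cite: MochizukiEtTh2009, Prop 3.4 p.74] -/
theorem objectwise_isDivisorial_ofGaloisActionConnected :
    Objectwise (fun M _ => IsDivisorial M) (ofGaloisActionConnected A hZ).Φ₀ :=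
  fun Y => (isPerfFactorialCof_phiZero A Y.obj).1.isDivisorial

/-- **`Φ₀` is a MONOID ON `D₀`** ([FrdI] Def. 1.1 (ii)) over the connected coverings: pull-backs are characteristically
injective (surjective covering maps, sharp values) and bijective along FSM-morphisms (monomorphisms of connected
coverings are bijective). [cite: MochizukiEtTh2009, Prop 3.4 p.74] -/
theorem isMonoidOn_ofGaloisActionConnected : IsMonoidOn (ofGaloisActionConnected A hZ).Φ₀ := by
  refine ⟨fun {Y Y'} f => ?_, fun {Y Y'} f hf => ?_⟩
  · exact isCharInjective_of_injective_sharp _ (ofGaloisActionConnected_Φ₀_map_injective A hZ f.op)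
      (isPerfFactorialCof_phiZero A Y'.obj).1.isDivisorial.isSharp
  · haveI : Mono f := hf.2
    exact ofGaloisActionConnected_Φ₀_map_bijective_of_mono A hZ f

/-- **[EtTh] Prop. 3.4 — (i) in the weak reading of record and (ii) — is a THEOREM at the Def. 3.3 (iii) data of
the CONNECTED coverings dominated by one universal combinatorial covering**, at the tree's vocabularies
`treeMonoidVocabWeak` / `treeCatVocab` (whose [FrdI] Def. 4.5 rationality slots `R`, `R'` Prop. 3.4 does not read).
Inputs: the interface `Z : LogDivisorModel` (Def. 3.1 / Prop. 3.2 as fields), the Galois-action record `A`, and the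
tacit cusp laws `hZ` (binder, GAP G-w6d058-1). [cite: MochizukiEtTh2009, Prop 3.4 p.74] -/
theorem prop34_ofGaloisActionConnected
    (R R' : ((isConnectedGSet (G := G)).FullSubcategoryᵒᵖ ⥤ CommMonCat.{u}) → Prop) :
    (ofGaloisActionConnected A hZ).Prop34 treeMonoidVocabWeak.{u} (treeCatVocab _ R R') :=
  ⟨fun Y => prop34_i_phiZero A Y.unop.obj,
    fun Y f => isNonDilating_phiZeroPull A Y.unop.obj f.unop.hom,
    (treeCatVocab_isDivisorialOn _ R R' _).mpr
      ⟨isMonoidOn_ofGaloisActionConnected A hZ, objectwise_isDivisorial_ofGaloisActionConnected A hZ⟩,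
    fun Y _ h => mem_fZero_of_divZeroHom_eq_one A Y.unop.obj h,
    fun Y _ x h => mem_fZero_of_divZeroHom_eq_of A Y.unop.obj (x := x) h⟩

end DivisorMonoids

end Literature.AnabelianGeometry.EtaleTheta
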